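import Summits.QuantumFields.YangMills.Theorems.FluctuationComparisonRegPrIntLOrganTangentNearDisplacement
import Summits.QuantumFields.YangMills.Theorems.FluctuationComparisonRegPrIntLOrganTangentILawKnitFacts
import HarnessLib

/-!
# Crux `FluctuationComparisonRegPrIntL` (stmt-QuantumFields-20520, rung R3), PATH-B organ — «NEAR STABILITY FROM ONE-BOND DISPLACEMENT» at the T³ record
# (sequel of ✓`…OrganTangentNearDisplacement`: LEAD w3 g26 №42 (N4) — (L30)'s `hstabW` SHAPE, near-quantified, from the row's `hdisp`; DEFINITION-FREE)

Cell `ym3-torus` (YM ladder rung R3 = continuum `SU(2)` Yang–Mills on the three-torus — a RUNG: NOT d = 4, NOT infinite volume, NOT a mass gap, NOT Clay).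
Width seat `ym3-torus-px20` (gen 21); `--kind proof --supports stmt-QuantumFields-20520 --as helper`, count-neutral, no registry ∕ binder ∕ `Lines/` edit, default
heartbeats, `autoImplicit false`.  Over ✓`…OrganTangentNearDisplacement` §1–§2 (one-move ∕ corner ∕ relational-path ∕ relational-square `dist1` chaining of the one-bond
displacement clause `hdisp`), ✓p818026 `…OrganTangentILawKnitFacts` (`plaqSmall_mono`, `abs_le_two_of_mem_Icc`), ✓p817898 `…OrganTangentRelPathWindow`
(`plaqSmall_relPath_of_le`, `plaqSmall_relSquare_of_le`), ✓`T3DescentFibreTower.descendTo_self`.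

WHAT.  The near-pair replacement of ✓`hstabW_of_hglobW` ((I-geo-w)'s window-to-window letter `Dw` is NOT used): from the row's `hdisp` TEXT ((I-geo) of
`OrganDischargeInputsHJ` «b»: base point in the `θ_j`-window, one bond, `‖v‖ ≤ rc·(θ_j∕4)`, `s ∈ Icc 0 1`, `+ DP p b·(‖v‖∕(θ_j∕4))`, uniform cap `DP ≤ Db`, `0 ≤ Db`), the cut's
support `hχsupp` and the window guard `(1 + 16·√3·rc)·(θ_j∕4) ≤ θ_j` (from the head letter `√3·rc ≤ 3∕16`, ✓`hrc_of_sqrt3_mul_le`):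
* ★`hstab_of_near` — abstract: `mwCut (Φ (Xw, z)) ≠ 0` puts `Φ (Xw, z)` in the `24∕25·θ_Ts`-window, so a plaquette-wise bound `dist1 (Φ (U, z)) ≤ dist1 (Φ (Xw, z)) + D` and room
  `24∕25·θ_Ts + D ≤ c·θ_Ts` give `dist1 (plaqHol (Φ (U, z)) p) ≤ c·θ_Ts` — the `hstab` shape ✓p815882 ∕ JV0-E2E ∕ JT-E2E ∕ (L30) consume;
* ★★`hstab_corners_of_hdisp` — value AND law point ANY two corners of one admissible `θ_j∕4`-square (seed-clause relational shape), ROOM `24∕25·θ_Ts + 3·(Db·rc) ≤ c·θ_Ts`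
  (this seat's uniform `k = 3`: corner pairs need ≤ 3 moves since `b = b′` is allowed);
* ★`hstab_relPath_base_of_hdisp` (law point `X s`, `s ∈ Icc 0 1`, on the relational `B′`-path from `U₂`; value `U₂`; 1 move), ★`hstab_relPath_of_move_of_hdisp` (value corner one
  admissible move from the path's base, either orientation; 2 moves — the (L1ʲ-h)sq ∕ (JV3-h′)sq configurations), ★`hstab_relSquare_base_of_hdisp` (law point `X s s′` of the
  relational square from `V00`, value `V00`; 2 moves — (L2ʲ-h) ∕ (JV4-h′)) — all stated under the same `k = 3` room so ONE room serves the row-sq.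
So (I-geo)sq needs NO `hglobW`: near stability is DERIVED from `hdisp` (LEAD №38 (2)); the knit-sq's X∕V3∕L2∕V4 suppliers and the JV0∕JT producers invoked near take these by name.
INPUT LEFT TO PRINT: the displacement letters `DP` of Bałaban's minimiser-following chart ([Balaban1985Variational] Thm 1 (10) p.279, Prop 9 (190) p.309) — NOT constructed here.

HONEST FRAMING: bookkeeping over a HYPOTHESIS clause; nothing of Bałaban's analysis is asserted or proved; `SpreadFibreLawH(J)` ∕ `OrganDischargeInputsHJ` are HYPOTHESIS rows,
UNDISCHARGED and exactly as open; LIN″, JEN″, JVARᵘ-H″, O1ᵘ-H v2.2, S1aᴴ, S3ᴴ, S2α′, S2β, 26243, the five registered stubs of `Lines/semiclassical_s2beta.lean` (registry 3732b7df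
untouched), crux 20520 `FluctuationComparisonRegPrIntL` and `YM3TorusSU2` are NOT proved; no summit ∕ sub-problem statement is proved; rung R3 = SU(2) YM₃ on T³ at fixed lattice
data — NOT d = 4, NOT infinite volume, NOT a mass gap, NOT Clay; the Yang–Mills mass gap is NOT proved.  [folklore]
-/

set_option autoImplicit false

noncomputable section

namespace Summit.QuantumFields.YangMills.Theorems.OrganTangentNearStability

open Function Set
open Literature.MathematicalPhysics.QuantumFieldTheory.Balaban1983to89
open T4CubeChartExp (expPt)
open Summit.QuantumFields.YangMills.Theorems.OrganTangentNearDisplacement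

open T3ContinuumYM3Torus T3NestedUnitLaws T3UnitLawDensityEML T4Continuum BalabanUVClass T3UnitScaleTilt T3LevelShift T3TiltDescent
open Summit.QuantumFields.YangMills.Theorems.FluctuationComparisonRegPrIntLRunpairOrganFibreLaw (mwCut)
open Summit.QuantumFields.YangMills.Theorems.OrganTangentILawKnitFacts (plaqSmall_mono abs_le_two_of_mem_Icc)
open Summit.QuantumFields.YangMills.Theorems.OrganTangentRelPathWindow (plaqSmall_relPath_of_le plaqSmall_relSquare_of_le)

/-- ★ **NEAR STABILITY, abstract form**: the cut's support puts the law point's image in the `24∕25·θ_Ts`-window (`hχsupp` + ✓`descendTo_self`), so any value point whose image is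
plaquette-wise within `D` of it satisfies `dist1 ≤ c·θ_Ts` under room `24∕25·θ_Ts + D ≤ c·θ_Ts` — the `hstab` shape of ✓p815882 ∕ JV0-E2E ∕ JT-E2E. [folklore] -/
theorem hstab_of_near (F : T3Family) (γ b₀ p₀ : ℝ) (j Ts : ℕ) (hjTs : j + 1 ≤ Ts)
    (hχsupp : ∀ U, mwCut F γ b₀ p₀ j Ts U ≠ 0 → ∀ (n : ℕ) (hjn : j + 1 ≤ n) (hnK : n ≤ Ts), PlaqSmall (24 / 25 * θBal F.L γ b₀ p₀ n) (descendTo F ℰp n Ts hnK U))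
    {Z : Type} (Φ : GaugeField (F.P j) 0 ↥(Matrix.specialUnitaryGroup (Fin 2) ℂ) × Z → GaugeField (F.P Ts) 0 ↥(Matrix.specialUnitaryGroup (Fin 2) ℂ)) (c D : ℝ)
    (hroom : 24 / 25 * θBal F.L γ b₀ p₀ Ts + D ≤ c * θBal F.L γ b₀ p₀ Ts)
    (z : Z) (U Xw : GaugeField (F.P j) 0 ↥(Matrix.specialUnitaryGroup (Fin 2) ℂ))
    (hnear : ∀ p, dist1 (GaugeField.plaqHol (Φ (U, z)) p) ≤ dist1 (GaugeField.plaqHol (Φ (Xw, z)) p) + D)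
    (hχ : mwCut F γ b₀ p₀ j Ts (Φ (Xw, z)) ≠ 0) :
    ∀ p, dist1 (GaugeField.plaqHol (Φ (U, z)) p) ≤ c * θBal F.L γ b₀ p₀ Ts := by
  intro p
  have htop : PlaqSmall (24 / 25 * θBal F.L γ b₀ p₀ Ts) (Φ (Xw, z)) := by
    intro q
    have h := hχsupp _ hχ Ts hjTs le_rfl q
    rw [T3DescentFibreTower.descendTo_self] at h
    exact h
  have h1 := hnear p
  have h2 := htop p
  linarith

/-- ★★ **NEAR STABILITY FOR CORNER PAIRS from the row's `hdisp`** (value point AND law point any two corners of one admissible `θ_j∕4`-square; `Xw` may equal `X`): the (I-geo)sq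
replacement of ✓`hstabW_of_hglobW`, with ROOM `24∕25·θ_Ts + 3·(Db·rc) ≤ c·θ_Ts` (`k = 3`) and NO window-to-window letter. [folklore] -/
theorem hstab_corners_of_hdisp (F : T3Family) (γ b₀ p₀ : ℝ) (j Ts : ℕ) (hjTs : j + 1 ≤ Ts)
    (hχsupp : ∀ U, mwCut F γ b₀ p₀ j Ts U ≠ 0 → ∀ (n : ℕ) (hjn : j + 1 ≤ n) (hnK : n ≤ Ts), PlaqSmall (24 / 25 * θBal F.L γ b₀ p₀ n) (descendTo F ℰp n Ts hnK U))
    {Z : Type} (Φ : GaugeField (F.P j) 0 ↥(Matrix.specialUnitaryGroup (Fin 2) ℂ) × Z → GaugeField (F.P Ts) 0 ↥(Matrix.specialUnitaryGroup (Fin 2) ℂ))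
    (hθj : 0 < θBal F.L γ b₀ p₀ j) (c Db rc : ℝ) (hrc : 0 ≤ rc) (hDb0 : 0 ≤ Db) (DP : Plaq (F.P Ts) 0 → PBond (F.P j) 0 → ℝ) (hDb : ∀ p b, DP p b ≤ Db)
    (hdisp : ∀ (z : Z) (X : GaugeField (F.P j) 0 ↥(Matrix.specialUnitaryGroup (Fin 2) ℂ)), PlaqSmall (θBal F.L γ b₀ p₀ j) X →
      ∀ (b : PBond (F.P j) 0) (v : Fin 3 → ℝ), ‖v‖ ≤ rc * (θBal F.L γ b₀ p₀ j / 4) → ∀ s ∈ Icc (0 : ℝ) 1, ∀ p : Plaq (F.P Ts) 0,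
        dist1 (GaugeField.plaqHol (Φ (update X b (X b * expPt (s • v)), z)) p)
          ≤ dist1 (GaugeField.plaqHol (Φ (X, z)) p) + DP p b * (‖v‖ / (θBal F.L γ b₀ p₀ j / 4)))
    (hroom : 24 / 25 * θBal F.L γ b₀ p₀ Ts + 3 * (Db * rc) ≤ c * θBal F.L γ b₀ p₀ Ts) :
    ∀ (z : Z) (b b' : PBond (F.P j) 0) (v v' : Fin 3 → ℝ) (U V W Y : GaugeField (F.P j) 0 ↥(Matrix.specialUnitaryGroup (Fin 2) ℂ)),
      ‖v‖ ≤ rc * (θBal F.L γ b₀ p₀ j / 4) → ‖v'‖ ≤ rc * (θBal F.L γ b₀ p₀ j / 4) →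
      PlaqSmall (θBal F.L γ b₀ p₀ j / 4) U → PlaqSmall (θBal F.L γ b₀ p₀ j / 4) V → PlaqSmall (θBal F.L γ b₀ p₀ j / 4) W → PlaqSmall (θBal F.L γ b₀ p₀ j / 4) Y →
      (∀ e, e ≠ b → V e = U e) → V b = U b * expPt v → (∀ e, e ≠ b' → W e = U e) → W b' = U b' * expPt v' →
      (∀ e, e ≠ b' → Y e = V e) → Y b' = V b' * expPt v' →
      ∀ (X Xw : GaugeField (F.P j) 0 ↥(Matrix.specialUnitaryGroup (Fin 2) ℂ)), (X = U ∨ X = V ∨ X = W ∨ X = Y) → (Xw = U ∨ Xw = V ∨ Xw = W ∨ Xw = Y) →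
      mwCut F γ b₀ p₀ j Ts (Φ (Xw, z)) ≠ 0 → ∀ p, dist1 (GaugeField.plaqHol (Φ (X, z)) p) ≤ c * θBal F.L γ b₀ p₀ Ts := by
  intro z b b' v v' U V W Y hv hv' hU hV hW hY hVoff hVon hWoff hWon hYoff hYon X Xw hX hXw hχ
  have hθ4 : 0 < θBal F.L γ b₀ p₀ j / 4 := by positivity
  have hq : θBal F.L γ b₀ p₀ j / 4 ≤ θBal F.L γ b₀ p₀ j := by linarith
  have hnear := dist1_chart_corner_corner_le hθ4 hrc (fun X => Φ (X, z)) DP (hdisp z) hDb0 hDb hv hv'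
    (plaqSmall_mono hq hU) (plaqSmall_mono hq hV) (plaqSmall_mono hq hW) (plaqSmall_mono hq hY) hVoff hVon hWoff hWon hYoff hYon hX hXw
  exact hstab_of_near F γ b₀ p₀ j Ts hjTs hχsupp Φ c (3 * (Db * rc)) hroom z X Xw hnear hχ

/-- The window guard of the rows (`(1 + 16·√3·rc)·(θ_j∕4) ≤ θ_j`, from `√3·rc ≤ 3∕16`) also gives the one-move guard `(1 + 8·√3·rc)·(θ_j∕4) ≤ θ_j`. [folklore] -/
theorem guard8_of_guard16 {rc θ : ℝ} (hrc0 : 0 ≤ rc) (hθ : 0 ≤ θ) (hrc : (1 + 16 * Real.sqrt 3 * rc) * (θ / 4) ≤ θ) :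
    (1 + 8 * Real.sqrt 3 * rc) * (θ / 4) ≤ θ := by
  have h3 : 0 ≤ Real.sqrt 3 * rc := mul_nonneg (Real.sqrt_nonneg 3) hrc0
  nlinarith

/-- ★ **NEAR STABILITY, RELATIONAL LAW PATH vs ITS BASE** (`k = 1`): law point `X s` (`s ∈ Icc 0 1`) on the relational `B′`-path from the `θ_j∕4`-corner `U₂` (`‖m′‖ ≤ rc·θ_j∕4`),
value point `U₂`; window guard `(1 + 16·√3·rc)·(θ_j∕4) ≤ θ_j`; room `24∕25·θ_Ts + 3·(Db·rc) ≤ c·θ_Ts` (one move used). [folklore] -/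
theorem hstab_relPath_base_of_hdisp (F : T3Family) (γ b₀ p₀ : ℝ) (j Ts : ℕ) (hjTs : j + 1 ≤ Ts)
    (hχsupp : ∀ U, mwCut F γ b₀ p₀ j Ts U ≠ 0 → ∀ (n : ℕ) (hjn : j + 1 ≤ n) (hnK : n ≤ Ts), PlaqSmall (24 / 25 * θBal F.L γ b₀ p₀ n) (descendTo F ℰp n Ts hnK U))
    {Z : Type} (Φ : GaugeField (F.P j) 0 ↥(Matrix.specialUnitaryGroup (Fin 2) ℂ) × Z → GaugeField (F.P Ts) 0 ↥(Matrix.specialUnitaryGroup (Fin 2) ℂ))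
    (hθj : 0 < θBal F.L γ b₀ p₀ j) (c Db rc : ℝ) (hrc : 0 ≤ rc) (hDb0 : 0 ≤ Db) (DP : Plaq (F.P Ts) 0 → PBond (F.P j) 0 → ℝ) (hDb : ∀ p b, DP p b ≤ Db)
    (hguard : (1 + 16 * Real.sqrt 3 * rc) * (θBal F.L γ b₀ p₀ j / 4) ≤ θBal F.L γ b₀ p₀ j)
    (hdisp : ∀ (z : Z) (X : GaugeField (F.P j) 0 ↥(Matrix.specialUnitaryGroup (Fin 2) ℂ)), PlaqSmall (θBal F.L γ b₀ p₀ j) X →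
      ∀ (b : PBond (F.P j) 0) (v : Fin 3 → ℝ), ‖v‖ ≤ rc * (θBal F.L γ b₀ p₀ j / 4) → ∀ s ∈ Icc (0 : ℝ) 1, ∀ p : Plaq (F.P Ts) 0,
        dist1 (GaugeField.plaqHol (Φ (update X b (X b * expPt (s • v)), z)) p)
          ≤ dist1 (GaugeField.plaqHol (Φ (X, z)) p) + DP p b * (‖v‖ / (θBal F.L γ b₀ p₀ j / 4)))
    (hroom : 24 / 25 * θBal F.L γ b₀ p₀ Ts + 3 * (Db * rc) ≤ c * θBal F.L γ b₀ p₀ Ts) :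
    ∀ (z : Z) (B' : PBond (F.P j) 0) (m' : Fin 3 → ℝ) (U₂ : GaugeField (F.P j) 0 ↥(Matrix.specialUnitaryGroup (Fin 2) ℂ))
      (X : ℝ → GaugeField (F.P j) 0 ↥(Matrix.specialUnitaryGroup (Fin 2) ℂ)), ‖m'‖ ≤ rc * (θBal F.L γ b₀ p₀ j / 4) →
      PlaqSmall (θBal F.L γ b₀ p₀ j / 4) U₂ → (∀ s e, e ≠ B' → X s e = U₂ e) → (∀ s, X s B' = U₂ B' * expPt (s • m')) →
      ∀ s ∈ Icc (0 : ℝ) 1, mwCut F γ b₀ p₀ j Ts (Φ (X s, z)) ≠ 0 → ∀ p, dist1 (GaugeField.plaqHol (Φ (U₂, z)) p) ≤ c * θBal F.L γ b₀ p₀ Ts := by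
  intro z B' m' U₂ X hm' hU₂ hoff hon s hs hχ
  have hθ4 : 0 < θBal F.L γ b₀ p₀ j / 4 := by positivity
  have hXs : PlaqSmall (θBal F.L γ b₀ p₀ j) (X s) :=
    plaqSmall_mono (guard8_of_guard16 hrc hθj.le hguard) (plaqSmall_relPath_of_le hU₂ hm' hoff hon (abs_le_two_of_mem_Icc hs))
  have h1 := dist1_chart_le_relPath hθ4 (fun X => Φ (X, z)) DP (hdisp z) hDb0 hDb hoff hon hm' (abs_le_one_of_mem_Icc hs) hXs
  have hD : 0 ≤ Db * rc := mul_nonneg hDb0 hrc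
  exact hstab_of_near F γ b₀ p₀ j Ts hjTs hχsupp Φ c (3 * (Db * rc)) hroom z U₂ (X s) (fun p => by linarith [h1 p]) hχ

/-- ★ **NEAR STABILITY, RELATIONAL LAW PATH vs A ONE-MOVE NEIGHBOUR OF ITS BASE** (`k = 2`; the (L1ʲ-h)sq ∕ (JV3-h′)sq configurations: the law edge starts at a corner `U₂`
adjacent to the value corner `X₁` — EITHER `U₂ = X₁·e^m@B` OR `X₁ = U₂·e^m@B`, `‖m‖ ≤ rc·θ_j∕4`, both in the `θ_j∕4`-window). [folklore] -/
theorem hstab_relPath_of_move_of_hdisp (F : T3Family) (γ b₀ p₀ : ℝ) (j Ts : ℕ) (hjTs : j + 1 ≤ Ts)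
    (hχsupp : ∀ U, mwCut F γ b₀ p₀ j Ts U ≠ 0 → ∀ (n : ℕ) (hjn : j + 1 ≤ n) (hnK : n ≤ Ts), PlaqSmall (24 / 25 * θBal F.L γ b₀ p₀ n) (descendTo F ℰp n Ts hnK U))
    {Z : Type} (Φ : GaugeField (F.P j) 0 ↥(Matrix.specialUnitaryGroup (Fin 2) ℂ) × Z → GaugeField (F.P Ts) 0 ↥(Matrix.specialUnitaryGroup (Fin 2) ℂ))
    (hθj : 0 < θBal F.L γ b₀ p₀ j) (c Db rc : ℝ) (hrc : 0 ≤ rc) (hDb0 : 0 ≤ Db) (DP : Plaq (F.P Ts) 0 → PBond (F.P j) 0 → ℝ) (hDb : ∀ p b, DP p b ≤ Db)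
    (hguard : (1 + 16 * Real.sqrt 3 * rc) * (θBal F.L γ b₀ p₀ j / 4) ≤ θBal F.L γ b₀ p₀ j)
    (hdisp : ∀ (z : Z) (X : GaugeField (F.P j) 0 ↥(Matrix.specialUnitaryGroup (Fin 2) ℂ)), PlaqSmall (θBal F.L γ b₀ p₀ j) X →
      ∀ (b : PBond (F.P j) 0) (v : Fin 3 → ℝ), ‖v‖ ≤ rc * (θBal F.L γ b₀ p₀ j / 4) → ∀ s ∈ Icc (0 : ℝ) 1, ∀ p : Plaq (F.P Ts) 0,
        dist1 (GaugeField.plaqHol (Φ (update X b (X b * expPt (s • v)), z)) p)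
          ≤ dist1 (GaugeField.plaqHol (Φ (X, z)) p) + DP p b * (‖v‖ / (θBal F.L γ b₀ p₀ j / 4)))
    (hroom : 24 / 25 * θBal F.L γ b₀ p₀ Ts + 3 * (Db * rc) ≤ c * θBal F.L γ b₀ p₀ Ts) :
    ∀ (z : Z) (B B' : PBond (F.P j) 0) (m m' : Fin 3 → ℝ) (X₁ U₂ : GaugeField (F.P j) 0 ↥(Matrix.specialUnitaryGroup (Fin 2) ℂ))
      (X : ℝ → GaugeField (F.P j) 0 ↥(Matrix.specialUnitaryGroup (Fin 2) ℂ)), ‖m‖ ≤ rc * (θBal F.L γ b₀ p₀ j / 4) → ‖m'‖ ≤ rc * (θBal F.L γ b₀ p₀ j / 4) →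
      PlaqSmall (θBal F.L γ b₀ p₀ j / 4) X₁ → PlaqSmall (θBal F.L γ b₀ p₀ j / 4) U₂ →
      (((∀ e, e ≠ B → U₂ e = X₁ e) ∧ U₂ B = X₁ B * expPt m) ∨ ((∀ e, e ≠ B → X₁ e = U₂ e) ∧ X₁ B = U₂ B * expPt m)) →
      (∀ s e, e ≠ B' → X s e = U₂ e) → (∀ s, X s B' = U₂ B' * expPt (s • m')) →
      ∀ s ∈ Icc (0 : ℝ) 1, mwCut F γ b₀ p₀ j Ts (Φ (X s, z)) ≠ 0 → ∀ p, dist1 (GaugeField.plaqHol (Φ (X₁, z)) p) ≤ c * θBal F.L γ b₀ p₀ Ts := by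
  intro z B B' m m' X₁ U₂ X hm hm' hX₁ hU₂ hrel hoff hon s hs hχ
  have hθ4 : 0 < θBal F.L γ b₀ p₀ j / 4 := by positivity
  have hq : θBal F.L γ b₀ p₀ j / 4 ≤ θBal F.L γ b₀ p₀ j := by linarith
  have hXs : PlaqSmall (θBal F.L γ b₀ p₀ j) (X s) :=
    plaqSmall_mono (guard8_of_guard16 hrc hθj.le hguard) (plaqSmall_relPath_of_le hU₂ hm' hoff hon (abs_le_two_of_mem_Icc hs))
  have h1 := dist1_chart_le_relPath hθ4 (fun X => Φ (X, z)) DP (hdisp z) hDb0 hDb hoff hon hm' (abs_le_one_of_mem_Icc hs) hXs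
  have hD : 0 ≤ Db * rc := mul_nonneg hDb0 hrc
  -- value corner `X₁` vs the path's base `U₂`: one move, either orientation
  have h2 : ∀ p, dist1 (GaugeField.plaqHol (Φ (X₁, z)) p) ≤ dist1 (GaugeField.plaqHol (Φ (U₂, z)) p) + Db * rc := by
    intro p
    rcases hrel with ⟨hoff₁, hon₁⟩ | ⟨hoff₁, hon₁⟩
    · exact dist1_chart_le_rel hθ4 (fun X => Φ (X, z)) DP (hdisp z) hDb0 hDb hoff₁ hon₁ hm (plaqSmall_mono hq hU₂) p
    · exact dist1_chart_rel_le hθ4 (fun X => Φ (X, z)) DP (hdisp z) hDb0 hDb hoff₁ hon₁ hm (plaqSmall_mono hq hU₂) p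
  exact hstab_of_near F γ b₀ p₀ j Ts hjTs hχsupp Φ c (3 * (Db * rc)) hroom z X₁ (X s) (fun p => by linarith [h1 p, h2 p]) hχ

/-- ★ **NEAR STABILITY, RELATIONAL LAW SQUARE vs ITS BASE** (`k = 2`; the (L2ʲ-h) ∕ (JV4-h′) configurations): law point `X s s′` (`s, s′ ∈ Icc 0 1`) of the relational square
from the `θ_j∕4`-corner `V00` (`Y` its `B`-path, `X s ·` the `B′`-move of `Y s`), value point `V00`. [folklore] -/
theorem hstab_relSquare_base_of_hdisp (F : T3Family) (γ b₀ p₀ : ℝ) (j Ts : ℕ) (hjTs : j + 1 ≤ Ts)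
    (hχsupp : ∀ U, mwCut F γ b₀ p₀ j Ts U ≠ 0 → ∀ (n : ℕ) (hjn : j + 1 ≤ n) (hnK : n ≤ Ts), PlaqSmall (24 / 25 * θBal F.L γ b₀ p₀ n) (descendTo F ℰp n Ts hnK U))
    {Z : Type} (Φ : GaugeField (F.P j) 0 ↥(Matrix.specialUnitaryGroup (Fin 2) ℂ) × Z → GaugeField (F.P Ts) 0 ↥(Matrix.specialUnitaryGroup (Fin 2) ℂ))
    (hθj : 0 < θBal F.L γ b₀ p₀ j) (c Db rc : ℝ) (hrc : 0 ≤ rc) (hDb0 : 0 ≤ Db) (DP : Plaq (F.P Ts) 0 → PBond (F.P j) 0 → ℝ) (hDb : ∀ p b, DP p b ≤ Db)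
    (hguard : (1 + 16 * Real.sqrt 3 * rc) * (θBal F.L γ b₀ p₀ j / 4) ≤ θBal F.L γ b₀ p₀ j)
    (hdisp : ∀ (z : Z) (X : GaugeField (F.P j) 0 ↥(Matrix.specialUnitaryGroup (Fin 2) ℂ)), PlaqSmall (θBal F.L γ b₀ p₀ j) X →
      ∀ (b : PBond (F.P j) 0) (v : Fin 3 → ℝ), ‖v‖ ≤ rc * (θBal F.L γ b₀ p₀ j / 4) → ∀ s ∈ Icc (0 : ℝ) 1, ∀ p : Plaq (F.P Ts) 0,
        dist1 (GaugeField.plaqHol (Φ (update X b (X b * expPt (s • v)), z)) p)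
          ≤ dist1 (GaugeField.plaqHol (Φ (X, z)) p) + DP p b * (‖v‖ / (θBal F.L γ b₀ p₀ j / 4)))
    (hroom : 24 / 25 * θBal F.L γ b₀ p₀ Ts + 3 * (Db * rc) ≤ c * θBal F.L γ b₀ p₀ Ts) :
    ∀ (z : Z) (B B' : PBond (F.P j) 0) (m m' : Fin 3 → ℝ) (V00 : GaugeField (F.P j) 0 ↥(Matrix.specialUnitaryGroup (Fin 2) ℂ))
      (Y : ℝ → GaugeField (F.P j) 0 ↥(Matrix.specialUnitaryGroup (Fin 2) ℂ)) (X : ℝ → ℝ → GaugeField (F.P j) 0 ↥(Matrix.specialUnitaryGroup (Fin 2) ℂ)),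
      ‖m‖ ≤ rc * (θBal F.L γ b₀ p₀ j / 4) → ‖m'‖ ≤ rc * (θBal F.L γ b₀ p₀ j / 4) → PlaqSmall (θBal F.L γ b₀ p₀ j / 4) V00 →
      (∀ s e, e ≠ B → Y s e = V00 e) → (∀ s, Y s B = V00 B * expPt (s • m)) →
      (∀ s s' e, e ≠ B' → X s s' e = Y s e) → (∀ s s', X s s' B' = Y s B' * expPt (s' • m')) →
      ∀ s ∈ Icc (0 : ℝ) 1, ∀ s' ∈ Icc (0 : ℝ) 1, mwCut F γ b₀ p₀ j Ts (Φ (X s s', z)) ≠ 0 →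
      ∀ p, dist1 (GaugeField.plaqHol (Φ (V00, z)) p) ≤ c * θBal F.L γ b₀ p₀ Ts := by
  intro z B B' m m' V00 Y X hm hm' hV hYoff hYon hXoff hXon s hs s' hs' hχ
  have hθ4 : 0 < θBal F.L γ b₀ p₀ j / 4 := by positivity
  have hYs : PlaqSmall (θBal F.L γ b₀ p₀ j) (Y s) :=
    plaqSmall_mono (guard8_of_guard16 hrc hθj.le hguard) (plaqSmall_relPath_of_le hV hm hYoff hYon (abs_le_two_of_mem_Icc hs))
  have hXss : PlaqSmall (θBal F.L γ b₀ p₀ j) (X s s') :=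
    plaqSmall_mono hguard (plaqSmall_relSquare_of_le hV hm hm' hYoff hYon hXoff hXon (abs_le_two_of_mem_Icc hs) (abs_le_two_of_mem_Icc hs'))
  have hq : θBal F.L γ b₀ p₀ j / 4 ≤ θBal F.L γ b₀ p₀ j := by linarith
  have hD : 0 ≤ Db * rc := mul_nonneg hDb0 hrc
  refine hstab_of_near F γ b₀ p₀ j Ts hjTs hχsupp Φ c (3 * (Db * rc)) hroom z V00 (X s s') (fun p => ?_) hχ
  have h2 := (dist1_chart_relSquare hθ4 (fun X => Φ (X, z)) DP (hdisp z) hDb0 hDb hm hm' hYoff hYon hXoff hXon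
    (abs_le_one_of_mem_Icc hs) (abs_le_one_of_mem_Icc hs') (plaqSmall_mono hq hV) hYs hXss p).2
  linarith

end Summit.QuantumFields.YangMills.Theorems.OrganTangentNearStability

end
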